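import Mathlib
import HarnessLib

/-!
# Slicing a finite product of probability spaces one coordinate at a time (Bochner form), and the law of `wᵢ · T(w)` under product Haar measure

HONEST FRAMING: exact (Metropolis-corrected) sampling algorithms for lattice gauge theory;
figures of merit are autocorrelation/cost numbers at stated couplings and volumes; no
continuum-physics claim.

Venture `LatticeQCDFlow` (cell pub-lqcd), sub-topic `Scoring`; FANOUT row 5 (`s0-sun-a`), GEN-10.
NEW WORK of the cell (placement rule); measure-theoretic plumbing for step 6b of row 5's route to the
exact SU(2) torus formula (the `d = 2` evaluation of the Haar integrals of character products of
`Scoring/SU2LatticeCharacterExpansion.lean` by face merging and handle integrations, each of which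
integrates out ONE link of the product Haar measure `Haar^{⊗E}`).  Mathlib's `lmarginal` does this
for `ℝ≥0∞`-valued integrands only; the character integrands are signed, so we need the Bochner form:

* `measurePreserving_update` — for a probability measure `ν` on `X` and a finite index type `ι`,
  the map `(w, g) ↦ Function.update w i g` pushes `ν^{⊗ι} ⊗ ν` forward to `ν^{⊗ι}`;
* **`integral_pi_eq_integral_update`** — hence for every integrable `f : (ι → X) → E`,
  `∫ f dν^{⊗ι} = ∫ (∫ f(update w i g) dν(g)) dν^{⊗ι}(w)` (integrate the coordinate `i` first);
* `integral_pi_comp_eval` — a function of one coordinate integrates as under `ν`;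
* **`integral_pi_mul_of_update_eq`** — on a group with a right-invariant probability measure `ν`
  (e.g. the Haar probability of a compact group): if `T(w)` does not depend on the coordinate `i`, then
  `∫ φ(wᵢ · T(w)) dν^{⊗ι}(w) = ∫ φ dν` — the product of a Haar coordinate with anything independent of
  it is Haar distributed (used for the ordered product of the links of a lattice row);
* `integrable_of_continuous_compactSpace` — continuous real functions on a compact space are
  integrable for a finite measure (the integrability side condition of the slice formula for the
  character integrands on `SU(2)^E`).

Elementary; nothing is cited; no `def`.
-/

noncomputable section

open MeasureTheory Function Set

namespace Summit.Ventures.LatticeQCDFlow.Scoring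

/-! ## §1. The update map `(w, g) ↦ update w i g` preserves product probability measure -/

section Update

variable {ι : Type*} [Fintype ι] [DecidableEq ι] {X : Type*} [MeasurableSpace X]
  (ν : Measure X) [IsProbabilityMeasure ν]

omit [Fintype ι] [MeasurableSpace X] in
/-- The preimage of a box under the update map: `update w i g ∈ ∏ⱼ sⱼ` iff `g ∈ sᵢ` and `wⱼ ∈ sⱼ`
for `j ≠ i`. -/
theorem update_preimage_univ_pi (i : ι) (s : ι → Set X) :
    (fun p : (ι → X) × X => update p.1 i p.2) ⁻¹' (Set.pi univ s) =
      (Set.pi univ (update s i univ)) ×ˢ (s i) := by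
  ext ⟨w, g⟩
  simp only [mem_preimage, mem_univ_pi, mem_prod]
  constructor
  · intro h
    refine ⟨fun j => ?_, by simpa using h i⟩
    by_cases hj : j = i
    · subst hj; simp
    · rw [update_of_ne hj]
      have := h j
      rwa [update_of_ne hj] at this
  · rintro ⟨h1, h2⟩ j
    by_cases hj : j = i
    · subst hj; simpa using h2
    · rw [update_of_ne hj]
      have := h1 j
      rwa [update_of_ne hj] at this

/-- **The update map preserves product probability measure**: `(w, g) ↦ update w i g` pushes
`ν^{⊗ι} ⊗ ν` forward to `ν^{⊗ι}` (the old coordinate `wᵢ` is forgotten; `ν` is a probability measure). -/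
theorem measurePreserving_update (i : ι) :
    MeasurePreserving (fun p : (ι → X) × X => update p.1 i p.2)
      ((Measure.pi fun _ : ι => ν).prod ν) (Measure.pi fun _ : ι => ν) := by
  refine ⟨measurable_update', ?_⟩
  symm
  refine Measure.pi_eq fun s hs => ?_
  rw [Measure.map_apply measurable_update' (MeasurableSet.univ_pi hs),
    update_preimage_univ_pi, Measure.prod_prod, Measure.pi_pi]
  have h1 : (∏ j, ν (update s i univ j)) = ∏ j ∈ Finset.univ.erase i, ν (s j) := by
    rw [← Finset.mul_prod_erase _ _ (Finset.mem_univ i), update_self, measure_univ, one_mul]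
    refine Finset.prod_congr rfl fun j hj => ?_
    rw [update_of_ne (Finset.ne_of_mem_erase hj)]
  rw [h1, ← Finset.prod_erase_mul _ _ (Finset.mem_univ i)]

/-- **Integrating out one coordinate (Bochner form).**  For a probability measure `ν` and an
integrable `f : (ι → X) → E`:
`∫ f dν^{⊗ι} = ∫ (∫ f(update w i g) dν(g)) dν^{⊗ι}(w)`. -/
theorem integral_pi_eq_integral_update {E : Type*} [NormedAddCommGroup E] [NormedSpace ℝ E]
    (i : ι) {f : (ι → X) → E} (hf : Integrable f (Measure.pi fun _ : ι => ν)) :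
    ∫ w, f w ∂(Measure.pi fun _ : ι => ν) =
      ∫ w, (∫ g, f (update w i g) ∂ν) ∂(Measure.pi fun _ : ι => ν) := by
  have hmp := measurePreserving_update ν i
  have h1 : ∫ p, f (update p.1 i p.2) ∂((Measure.pi fun _ : ι => ν).prod ν) =
      ∫ w, f w ∂(Measure.pi fun _ : ι => ν) := by
    have h := integral_map (μ := (Measure.pi fun _ : ι => ν).prod ν)
      (measurable_update' (a := i)).aemeasurable (f := f)
      (by rw [hmp.map_eq]; exact hf.aestronglyMeasurable)
    rw [hmp.map_eq] at h
    exact h.symm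
  rw [← h1, integral_prod]
  exact hmp.integrable_comp_of_integrable hf

omit [DecidableEq ι] in
/-- A function of ONE coordinate integrates under `ν^{⊗ι}` as under `ν`. -/
theorem integral_pi_comp_eval {E : Type*} [NormedAddCommGroup E] [NormedSpace ℝ E]
    (i : ι) {φ : X → E} (hφ : AEStronglyMeasurable φ ν) :
    ∫ w, φ (w i) ∂(Measure.pi fun _ : ι => ν) = ∫ g, φ g ∂ν := by
  have hmp := measurePreserving_eval (fun _ : ι => ν) i
  have h := integral_map (μ := Measure.pi fun _ : ι => ν) (measurable_pi_apply i).aemeasurable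
    (f := φ) (by rw [hmp.map_eq]; exact hφ)
  rw [hmp.map_eq] at h
  exact h.symm

end Update

/-! ## §2. Right-invariant probability measures on a group: `wᵢ · T(w)` is `ν`-distributed -/

section Group

variable {ι : Type*} [Fintype ι] [DecidableEq ι] {G : Type*} [Group G] [MeasurableSpace G]
  [MeasurableMul G]

/-- **`wᵢ · T(w)` is `ν`-distributed when `T` ignores the coordinate `i`.**  For a right-invariant
probability measure `ν` on a group (the Haar probability of a compact group), a finite index type,
a map `T : (ι → G) → G` with `T (update w i g) = T w`, and `φ` with `w ↦ φ(wᵢ · T(w))` integrable: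
`∫ φ(wᵢ · T(w)) dν^{⊗ι}(w) = ∫ φ dν`.  (With `T(w)` the ordered product of the other links of a lattice
row: the row holonomy of independent Haar links is Haar distributed.) -/
theorem integral_pi_mul_of_update_eq {E : Type*} [NormedAddCommGroup E] [NormedSpace ℝ E]
    [CompleteSpace E] (ν : Measure G) [IsProbabilityMeasure ν] [ν.IsMulRightInvariant] (i : ι)
    (T : (ι → G) → G) (hT : ∀ w g, T (update w i g) = T w) (φ : G → E)
    (hint : Integrable (fun w : ι → G => φ (w i * T w)) (Measure.pi fun _ : ι => ν)) :
    ∫ w, φ (w i * T w) ∂(Measure.pi fun _ : ι => ν) = ∫ g, φ g ∂ν := by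
  rw [integral_pi_eq_integral_update ν i hint]
  have h : ∀ w : ι → G, (∫ g, φ (update w i g i * T (update w i g)) ∂ν) = ∫ g, φ g ∂ν := by
    intro w
    simp_rw [update_self, hT]
    exact integral_mul_right_eq_self (fun g => φ g) (T w)
  simp_rw [h]
  rw [integral_const, probReal_univ, one_smul]

/-- The same with the coordinate on the right: `∫ φ(T(w) · wᵢ) dν^{⊗ι}(w) = ∫ φ dν` for a
left-invariant probability measure. -/
theorem integral_pi_mul_of_update_eq' {E : Type*} [NormedAddCommGroup E] [NormedSpace ℝ E]
    [CompleteSpace E] (ν : Measure G) [IsProbabilityMeasure ν] [ν.IsMulLeftInvariant]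
    (i : ι) (T : (ι → G) → G) (hT : ∀ w g, T (update w i g) = T w) (φ : G → E)
    (hint : Integrable (fun w : ι → G => φ (T w * w i)) (Measure.pi fun _ : ι => ν)) :
    ∫ w, φ (T w * w i) ∂(Measure.pi fun _ : ι => ν) = ∫ g, φ g ∂ν := by
  rw [integral_pi_eq_integral_update ν i hint]
  have h : ∀ w : ι → G, (∫ g, φ (T (update w i g) * update w i g i) ∂ν) = ∫ g, φ g ∂ν := by
    intro w
    simp_rw [update_self, hT]
    exact integral_mul_left_eq_self (fun g => φ g) (T w)
  simp_rw [h]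
  rw [integral_const, probReal_univ, one_smul]

end Group

/-! ## §3. Integrability of continuous functions on compact spaces -/

/-- A continuous real function on a compact space is integrable for every finite measure
(the integrability side condition of the slice formula on `SU(2)^E`). -/
theorem integrable_of_continuous_compactSpace {Ω : Type*} [TopologicalSpace Ω] [CompactSpace Ω]
    [MeasurableSpace Ω] [OpensMeasurableSpace Ω] {μ : Measure Ω} [IsFiniteMeasure μ]
    {f : Ω → ℝ} (hf : Continuous f) : Integrable f μ :=
  hf.integrable_of_hasCompactSupport (HasCompactSupport.of_compactSpace f)

end Summit.Ventures.LatticeQCDFlow.Scoring
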